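import Summits.BirchSwinnertonDyer.Rank1Residual.P2.CongruentClassSevenConfigurations
import Summits.BirchSwinnertonDyer.Rank1Residual.P2.DecompositionsThreePrimes
import HarnessLib

/-!
# Sub-lane «bsd-p2»: `Σ₁, Σ₂ (mod 2)` of `n = abc` in closed form (§5b of the series)

HONEST FRAMING (sub-lane «bsd-p2», run/shared/lean/b2b/bsd-rank1-residual/p2/, verbatim in every
file): the target of record is the FULL Birch–Swinnerton-Dyer formula for EVERY analytic-rank `≤ 1`
`E/ℚ` at ALL primes INCLUDING `2`; the odd-prime class ledger is referee A's; the `2`-part is OPEN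
(cells O1 = X5 ∖ CM and O12 = the CM corner) and under census by «bsd-p2». Census / instrument
output at `2` = EVIDENCE / conjecture items with held-out validation, NEVER a Literature fact;
certificates close PAIRS (one isogeny class, `p = 2`), never classes. This file asserts NO
arithmetic fact; PROVED identities in `𝔽₂` for ANY weight `g : ℕ → ℕ`: Tian–Yuan–Zhang's
`genusSum₁ (abc) g` and `genusSum₂ (abc) g` (tree definitions, `GenusPeriodsParity.lean`; `genusSum₂`
requires two DISTINCT blocks `d₀ ≡ 5,6,7`, `d₁ ≡ 1,2,3 (mod 8)`) reduced mod `2` to the five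
decompositions of §5a with their residue filters written as the bits `bitOf`, `pat₂`, `pat₃` of §1
(`natCast_genusSum₁_three`, `natCast_genusSum₂_three`), and — ERRATUM F-Σ2 / p2-lead T-81 (the printed second sum INCLUDES the `ℓ = 0` decomposition `{n}`; lit-1's `genusSum₂'`, `genusSum₂'_eq_genusSum₂_add_self`, p328335) — TYZ's second sum AS PRINTED: `natCast_genusSum₂'_three` = the `Σ₂` form plus `g(abc)` for `abc ≡ 5, 6, 7 (mod 8)`. Part of the five-file series `CongruentClassSevenConfigurations` (§1: configurations + the finite
check) → `CongruentClassSevenConfigTransfer` (§2–§4: the prime tuple's data ARE functions of its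
Legendre configuration) → `DecompositionsThreePrimes` (§5a) → `GenusSumsThreePrimes` (§5b) →
`CongruentClassSevenKernelGenusParity` (§6: the `hgen`-free lemma for `ω(n) = 3` and the family door);
WAKE-theoremU of p2-lead ML-42 (W1′), source p2-idea-2 `O-rhoG-NOTE.md` v0.4 §8–§9, dictionary
countersigned in `p2/monsky/lit/A44-REDEI-GRAPH-COUNTERSIGN.md`. Unit `b2b-bsdres-p2-monsky-lit` GEN 7; NEW file.

References: [TianYuanZhang2017] Thm 1.2 (the two sums, p0002 L112–L129 of arXiv:1411.4728);
[HardyWright2008] §5.2.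
-/

open Finset Literature.NumberTheory.EllipticCurves.TianYuanZhang2017

set_option autoImplicit false

namespace Summit.BirchSwinnertonDyer.Rank1Residual.P2

section GenusSums

/-- `if P then x else 0 = [P]·x` in `𝔽₂`. [cite: HardyWright2008, §5.2] -/
theorem ite_eq_bitOf_mul (P : Prop) [Decidable P] (x : ZMod 2) : (if P then x else 0) = bitOf P * x := by
  unfold bitOf; split_ifs <;> simp

/-- `[P] = [Q]` for equivalent `P`, `Q`. [cite: HardyWright2008, §5.2] -/
theorem bitOf_congr {P Q : Prop} [Decidable P] [Decidable Q] (h : P ↔ Q) : bitOf P = bitOf Q := by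
  unfold bitOf
  by_cases hQ : Q
  · rw [if_pos (h.mpr hQ), if_pos hQ]
  · rw [if_neg (fun hP => hQ (h.mp hP)), if_neg hQ]

/-- TYZ's `Σ₁`-filter on a two-block decomposition `{x, y}`: "at most one block `≢ 1 (mod 8)`" iff
`x ≡ 1` or `y ≡ 1 (mod 8)`. [cite: TianYuanZhang2017, Thm. 1.2 (Σ₁: dᵢ ≡ 1 (mod 8) for i > 0)] -/
theorem card_filter_pair_le_one_iff {x y : ℕ} (hxy : x ≠ y) :
    ((({x, y} : Finset ℕ).filter fun d => d % 8 ≠ 1).card ≤ 1) ↔ (x % 8 = 1 ∨ y % 8 = 1) := by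
  rw [Finset.card_le_one]
  simp only [Finset.mem_filter, Finset.mem_insert, Finset.mem_singleton]
  constructor
  · intro h
    by_contra hn
    exact hxy (h x ⟨Or.inl rfl, fun hx => hn (Or.inl hx)⟩ y ⟨Or.inr rfl, fun hy => hn (Or.inr hy)⟩)
  · rintro h u ⟨hu, hu1⟩ v ⟨hv, hv1⟩
    rcases hu with rfl | rfl <;> rcases hv with rfl | rfl
    · rfl
    · exact ((not_or.mpr ⟨hu1, hv1⟩) h).elim
    · exact ((not_or.mpr ⟨hv1, hu1⟩) h).elim
    · rfl

/-- TYZ's `Σ₁`-filter on the three-block decomposition `{a, b, c}`: at most one block `≢ 1 (mod 8)`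
iff at least two blocks are `≡ 1 (mod 8)`. [cite: TianYuanZhang2017, Thm. 1.2 (Σ₁)] -/
theorem card_filter_triple_le_one_iff {a b c : ℕ} (hab : a ≠ b) (hac : a ≠ c) (hbc : b ≠ c) :
    ((({a, b, c} : Finset ℕ).filter fun d => d % 8 ≠ 1).card ≤ 1) ↔
      ((a % 8 = 1 ∧ b % 8 = 1) ∨ (a % 8 = 1 ∧ c % 8 = 1) ∨ (b % 8 = 1 ∧ c % 8 = 1)) := by
  rw [Finset.card_le_one]
  simp only [Finset.mem_filter, Finset.mem_insert, Finset.mem_singleton]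
  constructor
  · intro h
    have hab' : ¬ (a % 8 ≠ 1 ∧ b % 8 ≠ 1) := fun hn =>
      hab (h a ⟨Or.inl rfl, hn.1⟩ b ⟨Or.inr (Or.inl rfl), hn.2⟩)
    have hac' : ¬ (a % 8 ≠ 1 ∧ c % 8 ≠ 1) := fun hn =>
      hac (h a ⟨Or.inl rfl, hn.1⟩ c ⟨Or.inr (Or.inr rfl), hn.2⟩)
    have hbc' : ¬ (b % 8 ≠ 1 ∧ c % 8 ≠ 1) := fun hn =>
      hbc (h b ⟨Or.inr (Or.inl rfl), hn.1⟩ c ⟨Or.inr (Or.inr rfl), hn.2⟩)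
    tauto
  · rintro h u ⟨hu, hu1⟩ v ⟨hv, hv1⟩
    rcases hu with rfl | rfl | rfl <;> rcases hv with rfl | rfl | rfl <;> first | rfl | (exfalso; tauto)

/-- The printed pattern predicate of `Σ₂` on a decomposition `D`. [cite: TianYuanZhang2017, Thm. 1.2 (Σ₂)] -/
theorem pat₂_iff (x y : ℕ) : pat₂ x y = true ↔
    (((x % 8 = 5 ∨ x % 8 = 6 ∨ x % 8 = 7) ∧ (y % 8 = 1 ∨ y % 8 = 2 ∨ y % 8 = 3)) ∨
     ((y % 8 = 5 ∨ y % 8 = 6 ∨ y % 8 = 7) ∧ (x % 8 = 1 ∨ x % 8 = 2 ∨ x % 8 = 3))) := by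
  unfold pat₂
  simp only [Bool.or_eq_true, Bool.and_eq_true, beq_iff_eq, or_assoc]

/-- `pat₂` only depends on residues mod `8`. [cite: TianYuanZhang2017, Thm. 1.2 (Σ₂)] -/
theorem pat₂_mod (x y : ℕ) : pat₂ (x % 8) (y % 8) = pat₂ x y := by
  unfold pat₂; simp only [Nat.mod_mod]

/-- `pat₃` only depends on residues mod `8`. [cite: TianYuanZhang2017, Thm. 1.2 (Σ₂)] -/
theorem pat₃_mod (x y z : ℕ) : pat₃ (x % 8) (y % 8) (z % 8) = pat₃ x y z := by
  unfold pat₃; simp only [pat₂_mod, Nat.mod_mod]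

/-- TYZ's `Σ₂`-filter on a two-block decomposition `{x, y}` is the pattern `pat₂ x y`.
[cite: TianYuanZhang2017, Thm. 1.2 (Σ₂: d₀ ≡ 5,6,7, d₁ ≡ 1,2,3 (mod 8))] -/
theorem sigma2Filter_pair_iff {x y : ℕ} (hxy : x ≠ y) :
    (∃ d₀ ∈ ({x, y} : Finset ℕ), ∃ d₁ ∈ ({x, y} : Finset ℕ), d₀ ≠ d₁ ∧
      (d₀ % 8 = 5 ∨ d₀ % 8 = 6 ∨ d₀ % 8 = 7) ∧ (d₁ % 8 = 1 ∨ d₁ % 8 = 2 ∨ d₁ % 8 = 3) ∧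
      ∀ d ∈ ({x, y} : Finset ℕ), d ≠ d₀ → d ≠ d₁ → d % 8 = 1) ↔ pat₂ x y = true := by
  rw [pat₂_iff]
  constructor
  · rintro ⟨d₀, hd₀, d₁, hd₁, hne, h0, h1, -⟩
    simp only [Finset.mem_insert, Finset.mem_singleton] at hd₀ hd₁
    rcases hd₀ with rfl | rfl <;> rcases hd₁ with rfl | rfl
    · exact absurd rfl hne
    · exact Or.inl ⟨h0, h1⟩
    · exact Or.inr ⟨h0, h1⟩
    · exact absurd rfl hne
  · rintro (⟨h0, h1⟩ | ⟨h0, h1⟩)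
    · refine ⟨x, by simp, y, by simp, hxy, h0, h1, fun d hd hdx hdy => ?_⟩
      simp only [Finset.mem_insert, Finset.mem_singleton] at hd
      rcases hd with rfl | rfl
      · exact absurd rfl hdx
      · exact absurd rfl hdy
    · refine ⟨y, by simp, x, by simp, hxy.symm, h0, h1, fun d hd hdy hdx => ?_⟩
      simp only [Finset.mem_insert, Finset.mem_singleton] at hd
      rcases hd with rfl | rfl
      · exact absurd rfl hdx
      · exact absurd rfl hdy

/-- TYZ's `Σ₂`-filter on the three-block decomposition `{a, b, c}` is the pattern `pat₃ a b c`.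
[cite: TianYuanZhang2017, Thm. 1.2 (Σ₂)] -/
theorem sigma2Filter_triple_iff {a b c : ℕ} (hab : a ≠ b) (hac : a ≠ c) (hbc : b ≠ c) :
    (∃ d₀ ∈ ({a, b, c} : Finset ℕ), ∃ d₁ ∈ ({a, b, c} : Finset ℕ), d₀ ≠ d₁ ∧
      (d₀ % 8 = 5 ∨ d₀ % 8 = 6 ∨ d₀ % 8 = 7) ∧ (d₁ % 8 = 1 ∨ d₁ % 8 = 2 ∨ d₁ % 8 = 3) ∧
      ∀ d ∈ ({a, b, c} : Finset ℕ), d ≠ d₀ → d ≠ d₁ → d % 8 = 1) ↔ pat₃ a b c = true := by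
  have key : ∀ x y z : ℕ, x ≠ y → x ≠ z → y ≠ z →
      ((∃ d₀ ∈ ({x, y, z} : Finset ℕ), ∃ d₁ ∈ ({x, y, z} : Finset ℕ), d₀ ≠ d₁ ∧
        (d₀ % 8 = 5 ∨ d₀ % 8 = 6 ∨ d₀ % 8 = 7) ∧ (d₁ % 8 = 1 ∨ d₁ % 8 = 2 ∨ d₁ % 8 = 3) ∧
        ∀ d ∈ ({x, y, z} : Finset ℕ), d ≠ d₀ → d ≠ d₁ → d % 8 = 1) ↔
      ((pat₂ x y = true ∧ z % 8 = 1) ∨ (pat₂ x z = true ∧ y % 8 = 1) ∨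
        (pat₂ y z = true ∧ x % 8 = 1))) := by
    intro x y z hxy hxz hyz
    simp only [pat₂_iff]
    constructor
    · rintro ⟨d₀, hd₀, d₁, hd₁, hne, h0, h1, hrest⟩
      simp only [Finset.mem_insert, Finset.mem_singleton] at hd₀ hd₁
      have mx : x ∈ ({x, y, z} : Finset ℕ) := by simp
      have my : y ∈ ({x, y, z} : Finset ℕ) := by simp
      have mz : z ∈ ({x, y, z} : Finset ℕ) := by simp
      rcases hd₀ with rfl | rfl | rfl <;> rcases hd₁ with rfl | rfl | rfl
      · exact absurd rfl hne
      · exact Or.inl ⟨Or.inl ⟨h0, h1⟩, hrest z mz hxz.symm hyz.symm⟩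
      · exact Or.inr (Or.inl ⟨Or.inl ⟨h0, h1⟩, hrest y my hxy.symm hyz⟩)
      · exact Or.inl ⟨Or.inr ⟨h0, h1⟩, hrest z mz hyz.symm hxz.symm⟩
      · exact absurd rfl hne
      · exact Or.inr (Or.inr ⟨Or.inl ⟨h0, h1⟩, hrest x mx hxy hxz⟩)
      · exact Or.inr (Or.inl ⟨Or.inr ⟨h0, h1⟩, hrest y my hyz hxy.symm⟩)
      · exact Or.inr (Or.inr ⟨Or.inr ⟨h0, h1⟩, hrest x mx hxz hxy⟩)
      · exact absurd rfl hne
    · have mem3 : ∀ d ∈ ({x, y, z} : Finset ℕ), d = x ∨ d = y ∨ d = z := fun d hd => by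
        simpa only [Finset.mem_insert, Finset.mem_singleton] using hd
      rintro ((⟨⟨h0, h1⟩ | ⟨h0, h1⟩, hz⟩) | (⟨⟨h0, h1⟩ | ⟨h0, h1⟩, hy⟩) | (⟨⟨h0, h1⟩ | ⟨h0, h1⟩, hx⟩))
      · refine ⟨x, by simp, y, by simp, hxy, h0, h1, fun d hd h h' => ?_⟩
        rcases mem3 d hd with rfl | rfl | rfl
        exacts [absurd rfl h, absurd rfl h', hz]
      · refine ⟨y, by simp, x, by simp, hxy.symm, h0, h1, fun d hd h h' => ?_⟩
        rcases mem3 d hd with rfl | rfl | rfl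
        exacts [absurd rfl h', absurd rfl h, hz]
      · refine ⟨x, by simp, z, by simp, hxz, h0, h1, fun d hd h h' => ?_⟩
        rcases mem3 d hd with rfl | rfl | rfl
        exacts [absurd rfl h, hy, absurd rfl h']
      · refine ⟨z, by simp, x, by simp, hxz.symm, h0, h1, fun d hd h h' => ?_⟩
        rcases mem3 d hd with rfl | rfl | rfl
        exacts [absurd rfl h', hy, absurd rfl h]
      · refine ⟨y, by simp, z, by simp, hyz, h0, h1, fun d hd h h' => ?_⟩
        rcases mem3 d hd with rfl | rfl | rfl
        exacts [hx, absurd rfl h, absurd rfl h']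
      · refine ⟨z, by simp, y, by simp, hyz.symm, h0, h1, fun d hd h h' => ?_⟩
        rcases mem3 d hd with rfl | rfl | rfl
        exacts [hx, absurd rfl h', absurd rfl h]
  rw [key a b c hab hac hbc]
  unfold pat₃
  simp only [Bool.or_eq_true, Bool.and_eq_true, beq_iff_eq, or_assoc]

variable {a b c : ℕ}

/-- **`Σ₁(abc) mod 2` in closed form** (any `g`): the five decompositions with their residue filters.
[cite: TianYuanZhang2017, Thm. 1.2 (the first sum)] -/
theorem natCast_genusSum₁_three (g : ℕ → ℕ) (ha : a.Prime) (hb : b.Prime) (hc : c.Prime)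
    (hab : a ≠ b) (hac : a ≠ c) (hbc : b ≠ c) :
    ((genusSum₁ (a * b * c) g : ℕ) : ZMod 2) =
      (g (a * b * c) : ZMod 2)
      + bitOf (a % 8 = 1 ∨ (b * c) % 8 = 1) * ((g a : ZMod 2) * (g (b * c) : ZMod 2))
      + bitOf (b % 8 = 1 ∨ (a * c) % 8 = 1) * ((g b : ZMod 2) * (g (a * c) : ZMod 2))
      + bitOf (c % 8 = 1 ∨ (a * b) % 8 = 1) * ((g c : ZMod 2) * (g (a * b) : ZMod 2))
      + bitOf ((a % 8 = 1 ∧ b % 8 = 1) ∨ (a % 8 = 1 ∧ c % 8 = 1) ∨ (b % 8 = 1 ∧ c % 8 = 1))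
          * ((g a : ZMod 2) * (g b : ZMod 2) * (g c : ZMod 2)) := by
  have ha_bc : a ≠ b * c := prime_ne_prime_mul ha hb hab
  have hb_ac : b ≠ a * c := prime_ne_prime_mul hb ha hab.symm
  have hc_ab : c ≠ a * b := prime_ne_prime_mul hc ha hac.symm
  unfold genusSum₁
  rw [Finset.sum_filter, Nat.cast_sum, sum_decompositions_three ha hb hc hab hac hbc]
  -- the one-block term
  have t1 : (((({a * b * c} : Finset ℕ).filter fun d => d % 8 ≠ 1).card ≤ 1)) :=
    (Finset.card_filter_le _ _).trans (by simp)
  rw [if_pos t1, Finset.prod_singleton]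
  -- the two-block terms and the three-block term
  simp only [Nat.cast_ite, Nat.cast_mul, Nat.cast_zero, ite_eq_bitOf_mul,
    bitOf_congr (card_filter_pair_le_one_iff ha_bc), bitOf_congr (card_filter_pair_le_one_iff hb_ac),
    bitOf_congr (card_filter_pair_le_one_iff hc_ab), bitOf_congr (card_filter_triple_le_one_iff hab hac hbc),
    Finset.prod_insert (show a ∉ ({b * c} : Finset ℕ) by simpa using ha_bc),
    Finset.prod_insert (show b ∉ ({a * c} : Finset ℕ) by simpa using hb_ac),
    Finset.prod_insert (show c ∉ ({a * b} : Finset ℕ) by simpa using hc_ab),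
    Finset.prod_insert (show a ∉ ({b, c} : Finset ℕ) by simp [hab, hac]),
    Finset.prod_insert (show b ∉ ({c} : Finset ℕ) by simpa using hbc), Finset.prod_singleton]
  ring

/-- **`Σ₂(abc) mod 2` in closed form** (any `g`): the one-block decomposition does not occur (two
distinct blocks are required); the two-block terms carry `pat₂`, the three-block term `pat₃`.
[cite: TianYuanZhang2017, Thm. 1.2 (the second sum)] -/
theorem natCast_genusSum₂_three (g : ℕ → ℕ) (ha : a.Prime) (hb : b.Prime) (hc : c.Prime)
    (hab : a ≠ b) (hac : a ≠ c) (hbc : b ≠ c) :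
    ((genusSum₂ (a * b * c) g : ℕ) : ZMod 2) =
      bitOf (pat₂ a (b * c) = true) * ((g a : ZMod 2) * (g (b * c) : ZMod 2))
      + bitOf (pat₂ b (a * c) = true) * ((g b : ZMod 2) * (g (a * c) : ZMod 2))
      + bitOf (pat₂ c (a * b) = true) * ((g c : ZMod 2) * (g (a * b) : ZMod 2))
      + bitOf (pat₃ a b c = true) * ((g a : ZMod 2) * (g b : ZMod 2) * (g c : ZMod 2)) := by
  have ha_bc : a ≠ b * c := prime_ne_prime_mul ha hb hab
  have hb_ac : b ≠ a * c := prime_ne_prime_mul hb ha hab.symm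
  have hc_ab : c ≠ a * b := prime_ne_prime_mul hc ha hac.symm
  unfold genusSum₂
  rw [Finset.sum_filter, Nat.cast_sum, sum_decompositions_three ha hb hc hab hac hbc]
  -- the one-block term vanishes: no two distinct blocks
  have t1 : ¬ (∃ d₀ ∈ ({a * b * c} : Finset ℕ), ∃ d₁ ∈ ({a * b * c} : Finset ℕ), d₀ ≠ d₁ ∧
      (d₀ % 8 = 5 ∨ d₀ % 8 = 6 ∨ d₀ % 8 = 7) ∧ (d₁ % 8 = 1 ∨ d₁ % 8 = 2 ∨ d₁ % 8 = 3) ∧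
      ∀ d ∈ ({a * b * c} : Finset ℕ), d ≠ d₀ → d ≠ d₁ → d % 8 = 1) := by
    rintro ⟨d₀, hd₀, d₁, hd₁, hne, -⟩
    rw [Finset.mem_singleton] at hd₀ hd₁
    exact hne (hd₀.trans hd₁.symm)
  rw [if_neg t1]
  simp only [Nat.cast_ite, Nat.cast_mul, Nat.cast_zero, ite_eq_bitOf_mul,
    bitOf_congr (sigma2Filter_pair_iff ha_bc), bitOf_congr (sigma2Filter_pair_iff hb_ac),
    bitOf_congr (sigma2Filter_pair_iff hc_ab), bitOf_congr (sigma2Filter_triple_iff hab hac hbc),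
    Finset.prod_insert (show a ∉ ({b * c} : Finset ℕ) by simpa using ha_bc),
    Finset.prod_insert (show b ∉ ({a * c} : Finset ℕ) by simpa using hb_ac),
    Finset.prod_insert (show c ∉ ({a * b} : Finset ℕ) by simpa using hc_ab),
    Finset.prod_insert (show a ∉ ({b, c} : Finset ℕ) by simp [hab, hac]),
    Finset.prod_insert (show b ∉ ({c} : Finset ℕ) by simpa using hbc), Finset.prod_singleton]
  ring

/-- **`Σ₂′(abc) mod 2` in closed form** (any `g`) — TYZ's second sum AS PRINTED, `genusSum₂'`, WITH
the `ℓ = 0` term `{abc}` (ERRATUM F-Σ2 / p2-lead T-81; lit-1's `genusSum₂'_eq_genusSum₂_add_self`): for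
`abc ≡ 5, 6, 7 (mod 8)` it is the `Σ₂` form of `natCast_genusSum₂_three` plus `g(abc)`.
[cite: TianYuanZhang2017, Thm. 1.2 (the second sum) and proof of Prop. 3.4 (p0016 L146)] -/
theorem natCast_genusSum₂'_three (g : ℕ → ℕ) (ha : a.Prime) (hb : b.Prime) (hc : c.Prime)
    (hab : a ≠ b) (hac : a ≠ c) (hbc : b ≠ c)
    (h8 : (a * b * c) % 8 = 5 ∨ (a * b * c) % 8 = 6 ∨ (a * b * c) % 8 = 7) :
    ((genusSum₂' (a * b * c) g : ℕ) : ZMod 2) =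
      (g (a * b * c) : ZMod 2)
      + bitOf (pat₂ a (b * c) = true) * ((g a : ZMod 2) * (g (b * c) : ZMod 2))
      + bitOf (pat₂ b (a * c) = true) * ((g b : ZMod 2) * (g (a * c) : ZMod 2))
      + bitOf (pat₂ c (a * b) = true) * ((g c : ZMod 2) * (g (a * b) : ZMod 2))
      + bitOf (pat₃ a b c = true) * ((g a : ZMod 2) * (g b : ZMod 2) * (g c : ZMod 2)) := by
  have h1 : 1 < a * b * c :=
    ha.one_lt.trans_le ((Nat.le_mul_of_pos_right a hb.pos).trans (Nat.le_mul_of_pos_right _ hc.pos))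
  rw [genusSum₂'_eq_genusSum₂_add_self h1 h8, Nat.cast_add, natCast_genusSum₂_three g ha hb hc hab hac hbc]
  ring

end GenusSums

end Summit.BirchSwinnertonDyer.Rank1Residual.P2
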